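import Literature.AnabelianGeometry.AbsoluteAnabelian.AbsTopIThm26Thm214RekeyedProofs
import Literature.AnabelianGeometry.EtaleTheta.SettingModelSemidirectTopology
import Literature.NumberTheory.EllipticCurves.CyclotomicZpExtension
import HarnessLib

/-!
# [AbsTopI] Thm 2.6 (vi) AS TYPED (`FundamentalExtension.Thm26vi`, FACT-LIST F-0250): the instance form
# PROVED at the cyclotomic extension `1 → ℤ_p(1) → ℤ_p(1) ⋊_χ G_ℚ → G_ℚ → 1`

S. Mochizuki, *Topics in Absolute Anabelian Geometry I: Generalities*, J. Math. Sci. Univ. Tokyo 19 (2012)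
[MochizukiAbsTopI2012], Thm 2.6 (vi), manuscript p. 22, with its proof p. 23 ll. 7–10:

  "In a similar vein, assertion (vi) follows immediately from the fact that `T_l(A)/G = 0` [again a
   consequence of the "Riemann hypothesis for abelian varieties over finite fields"], together with the
   fact that `G` is very elastic [cf. Theorem 1.7, (iii)]."

PROOF-ONLY companion (no definition, no instance, no named fact), abc-iut cell seat abc-iut-f-091 (gen 2),
fourth file on FACT-LIST row **F-0250** `FundamentalExtension.Thm26vi` after
`AbsTopISemiAbsoluteSchemaNegative.lean` (universal closure over abstract extensions REFUTED by the split
model `G_ℚ × ℤ_2`), `AbsTopIThm26vviPointInstances.lean` (instance PROVED at the DEGENERATE point extension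
`Π = G`, `Δ = 1`).  Here: the instance form PROVED at a NON-DEGENERATE extension with GENUINE arithmetic,

  `E_χ :  1 → ℤ_p(1) → ℤ_p(1) ⋊_χ G_ℚ → G_ℚ → 1`,   `χ = χ_p : G_ℚ → ℤ_p^×` the `p`-adic cyclotomic character

(the tree's continuous `GaloisRep.cyclotomicCharacter ℚ p`; the semidirect product is topologised along
`g ↦ (g.left, g.right)` with the tree's generic `SettingModel.Semidirect` plumbing).  By Kummer theory (not
constructed here — the tree has no étale `π₁`), `E_χ` is isomorphic to the geometrically pro-`p` extension of
[AbsTopI] Def 2.1 (ii) with construction data `(k, X, Y, Σ) = (ℚ, 𝔾_m, 𝔾_m, {p})` — `𝔾_m` is a geometrically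
connected smooth separated `ℚ`-scheme with log smooth compactification `ℙ¹ ⊃ 𝔾_m`, `π₁(𝔾_{m,ℚ̄})^{(p)} = ℤ_p(1)`,
and the unit section splits `π₁(𝔾_m) ↠ G_ℚ` — i.e. an extension **of AFG-type with construction data field the
NF `ℚ`**, squarely inside the printed hypotheses of Thm 2.6 (vi) ("either of AFG-type or of GSAFG-type";
"`k` is either an FF, an MLF, or an NF"; §2 p. 16: "quite general varieties of arbitrary dimension").

CONTENT (`FundamentalExtension.exists_cyclotomicModel_thm26vi`): `E_χ` SPLITS, has `Δ ≅ ℤ_p` topologically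
finitely generated and `≠ 1`, `Π` acts on `Δ` through `χ ∘ aug` (NON-TRIVIAL outer action), and

* the Tate-module hypothesis `hT` of the in-tree conditional forms `thm26vi_of_tfgNormalSubgroup_trivial` /
  `NFBase.thm26vi_of_invariantCharacters_trivial` (GAP-LEDGER G-L4t4-1: "every `Π`-invariant continuous
  character `Δ → ℤ_l` is trivial", the group-theoretic content of "`T_l(A)/G = 0`") HOLDS at `E_χ`, for every
  prime `l`, NON-VACUOUSLY: a `Π`-invariant `ψ : ℤ_p(1) → ℤ_l` satisfies `ψ((χ(σ) − 1)·x) = 0`; `χ` is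
  non-trivial (the tree's `GaloisRep.cyclotomicCharacter_rat_surjective`), so `χ(σ) − 1 = u·p^k ≠ 0` for some
  `σ`, whence `p^k·ψ = 0` and `ψ = 0` since `ℤ_l` is torsion-free — this IS the printed argument
  "`T_p(𝔾_m)_{G_ℚ}` is finite" at `X = 𝔾_m` (`invariantCharacters_trivial_of_conj_eq_mul`, stated for any
  `Π` in which some element acts on `Δ ≅ ℤ_p` as multiplication by a `p`-adic integer `c ≠ 1`);
* hence `E_χ.Thm26vi` HOLDS: every continuous `Π → ℤ_l` kills `ℤ_p(1)` (while `ℤ_p(1)` itself HAS non-trivial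
  continuous characters — clause (1) has content here), `ℤ_p(1)` is THE maximal topologically finitely
  generated closed normal subgroup of `ℤ_p(1) ⋊_χ G_ℚ` ([AbsAnab] Thm 1.1.2, PROVED in the tree:
  `galoisNF_tfgNormalSubgroup_trivial_holds`), and `Π` is not topologically finitely generated.

FACT-LIST reading for F-0250 after this file: «universal closure REFUTED; instance form PROVED at the
degenerate point extension AND at the cyclotomic model of the AFG-type extension of `𝔾_m/ℚ` (hT discharged)».
HONEST FRAMING: [AbsTopI] is a refereed, undisputed paper; the model is a group-theoretic construction, its
identification with `π₁(𝔾_{m,ℚ})^{(p)}` is classical Kummer theory and is NOT kernel-checked here; nothing here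
bears on the disputed [IUTchIII] Cor. 3.12 or takes a side on any author; typed ≠ proved elsewhere.
-/

noncomputable section

open Topology

universe u

namespace Literature.AnabelianGeometry.AbsoluteAnabelian

open Literature.NumberTheory.GaloisRepresentations
open Literature.AnabelianGeometry.EtaleTheta.SettingModel

/-! ## `ℤ_p` is topologically cyclic -/

/-- `ℤ_p` (written multiplicatively) is topologically finitely generated — indeed topologically generated by
`1`, since `ℤ` is dense in `ℤ_p`.  ([AbsTopI] §0 "topologically finitely generated"; used for Prop 2.2 at the
cyclotomic model.) [cite: MochizukiAbsTopI2012, §0 p.8] -/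
theorem isTopologicallyFinitelyGenerated_multiplicative_padicInt (p : ℕ) [Fact p.Prime] :
    IsTopologicallyFinitelyGenerated (Multiplicative ℤ_[p]) := by
  have hd : DenseRange (fun k : ℤ => Multiplicative.ofAdd ((k : ℤ_[p]))) :=
    (Multiplicative.ofAdd.surjective.denseRange).comp PadicInt.denseRange_intCast continuous_ofAdd
  have hsub : Set.range (fun k : ℤ => Multiplicative.ofAdd ((k : ℤ_[p]))) ⊆
      (Subgroup.zpowers (Multiplicative.ofAdd (1 : ℤ_[p])) : Set (Multiplicative ℤ_[p])) := by
    rintro _ ⟨k, rfl⟩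
    refine ⟨k, ?_⟩
    change Multiplicative.ofAdd (1 : ℤ_[p]) ^ k = Multiplicative.ofAdd (k : ℤ_[p])
    rw [← ofAdd_zsmul, zsmul_one]
  refine ⟨⟨{Multiplicative.ofAdd (1 : ℤ_[p])}, ?_⟩⟩
  apply SetLike.coe_injective
  rw [Subgroup.topologicalClosure_coe, Subgroup.coe_top, Finset.coe_singleton,
    ← Subgroup.zpowers_eq_closure]
  exact (Dense.mono hsub hd).closure_eq

namespace FundamentalExtension

/-! ## The group-theoretic content of "`T_p(A)/G` is finite": scalar action by `c ≠ 1` kills invariant characters -/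

/-- **The mechanism behind [AbsTopI] Thm 2.6 (vi)'s "`T_l(A)/G = 0`", at a rank-one geometric group.**  Let
`1 → Δ → Π → G → 1` be ANY extension of profinite groups whose `Δ` is the image of a homomorphism
`j : ℤ_p → Π`, and suppose some `g ∈ Π` acts on it as multiplication by a `p`-adic integer `c ≠ 1`:
`g · j(a) · g⁻¹ = j(c·a)`.  Then for every prime `l`, every `Π`-invariant continuous character `ψ : Δ → ℤ_l` is
trivial: `ψ ∘ j` is additive with `ψ(j((c−1)·a)) = 0`; writing `c − 1 = u·p^k` (`u` a unit) gives
`p^k · ψ(j(b)) = 0` for all `b`, and `ℤ_l` is torsion-free.  (No continuity is used: the hypothesis `hT` of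
`thm26vi_of_tfgNormalSubgroup_trivial` at such an extension.) [cite: MochizukiAbsTopI2012, Thm 2.6 (vi) p.22] -/
theorem invariantCharacters_trivial_of_conj_eq_mul (E : FundamentalExtension.{u}) {p : ℕ} [Fact p.Prime]
    (j : Multiplicative ℤ_[p] →* E.arith) (hj : j.range = E.geom) (g : E.arith) (c : ℤ_[p]) (hc : c ≠ 1)
    (hconj : ∀ a : ℤ_[p],
      g * j (Multiplicative.ofAdd a) * g⁻¹ = j (Multiplicative.ofAdd (c * a)))
    (l : ℕ) [Fact l.Prime] (ψ : E.geom →ₜ* Multiplicative ℤ_[l])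
    (hψ : ∀ (g : E.arith) (d d' : E.geom), (d' : E.arith) = g * d * g⁻¹ → ψ d' = ψ d) (d : E.geom) :
    ψ d = 1 := by
  -- `j` lands in `Δ`
  have hmem : ∀ a : ℤ_[p], j (Multiplicative.ofAdd a) ∈ E.geom := fun a => hj ▸ ⟨_, rfl⟩
  -- the additive character `F := ψ ∘ j : ℤ_p → ℤ_l`
  let F : ℤ_[p] →+ ℤ_[l] := AddMonoidHom.mk'
    (fun a => Multiplicative.toAdd (ψ ⟨j (Multiplicative.ofAdd a), hmem a⟩)) (by
      intro a b
      have hab : (⟨j (Multiplicative.ofAdd (a + b)), hmem (a + b)⟩ : E.geom) =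
          ⟨j (Multiplicative.ofAdd a), hmem a⟩ * ⟨j (Multiplicative.ofAdd b), hmem b⟩ := by
        apply Subtype.ext
        change j (Multiplicative.ofAdd (a + b)) = j (Multiplicative.ofAdd a) * j (Multiplicative.ofAdd b)
        rw [ofAdd_add, map_mul]
      rw [hab, map_mul, toAdd_mul])
  have hF : ∀ a, F a = Multiplicative.toAdd (ψ ⟨j (Multiplicative.ofAdd a), hmem a⟩) := fun a => rfl
  -- invariance under `g`: `F (c * a) = F a`
  have hinv : ∀ a, F (c * a) = F a := by
    intro a
    rw [hF, hF]
    congr 1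
    exact hψ g ⟨_, hmem a⟩ ⟨_, hmem (c * a)⟩ (hconj a).symm
  -- hence `F ((c - 1) * a) = 0`
  have hkill : ∀ a, F ((c - 1) * a) = 0 := by
    intro a
    rw [sub_mul, one_mul, map_sub, hinv, sub_self]
  -- `c - 1 = v * p ^ k` with `v` a unit
  have hc1 : c - 1 ≠ 0 := sub_ne_zero.mpr hc
  set k := (c - 1).valuation
  set v : ℤ_[p]ˣ := PadicInt.unitCoeff hc1
  have hspec : c - 1 = (v : ℤ_[p]) * (p : ℤ_[p]) ^ k := PadicInt.unitCoeff_spec hc1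
  have hpk : ∀ b : ℤ_[p], F ((p : ℤ_[p]) ^ k * b) = 0 := by
    intro b
    have h := hkill (((v⁻¹ : ℤ_[p]ˣ) : ℤ_[p]) * b)
    have hre : (c - 1) * ((((v⁻¹ : ℤ_[p]ˣ) : ℤ_[p])) * b) = (p : ℤ_[p]) ^ k * b := by
      rw [hspec, mul_comm (v : ℤ_[p]) _, mul_assoc, ← mul_assoc (v : ℤ_[p]), Units.mul_inv, one_mul]
    rwa [hre] at h
  -- so `p ^ k • F b = 0`, and `ℤ_l` is torsion-free
  have hzero : ∀ b : ℤ_[p], F b = 0 := by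
    intro b
    have h1 : ((p ^ k : ℕ) : ℤ_[l]) * F b = 0 := by
      have h := hpk b
      rw [← Nat.cast_pow, ← nsmul_eq_mul, ← map_nsmul, nsmul_eq_mul, Nat.cast_pow] at *
      exact h
    have hne : ((p ^ k : ℕ) : ℤ_[l]) ≠ 0 :=
      Nat.cast_ne_zero.mpr (pow_ne_zero k (Fact.out : p.Prime).ne_zero)
    exact (mul_eq_zero.mp h1).resolve_left hne
  -- every `d ∈ Δ` is some `j (ofAdd a)`
  have hle : E.geom ≤ j.range := hj.symm.le
  obtain ⟨m, hm⟩ := hle d.2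
  have hd : d = ⟨j (Multiplicative.ofAdd (Multiplicative.toAdd m)), hmem _⟩ := by
    apply Subtype.ext
    change (d : E.arith) = j (Multiplicative.ofAdd (Multiplicative.toAdd m))
    rw [ofAdd_toAdd, hm]
  rw [hd]
  have := hzero (Multiplicative.toAdd m)
  rw [hF, toAdd_eq_zero] at this
  exact this

/-! ## The cyclotomic extension `1 → ℤ_p(1) → ℤ_p(1) ⋊_χ G_ℚ → G_ℚ → 1` -/

/-- **FACT-LIST F-0250: [AbsTopI] Thm 2.6 (vi) AS TYPED holds at the cyclotomic extension
`1 → ℤ_p(1) → ℤ_p(1) ⋊_χ G_ℚ → G_ℚ → 1`** — the group-theoretic model of the geometrically pro-`p` AFG-type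
extension of `X = 𝔾_m` over the NF `k = ℚ` ([AbsTopI] Def 2.1 (ii), construction data `(ℚ, 𝔾_m, 𝔾_m, {p})`,
up to the Kummer identification `π₁(𝔾_{m,ℚ̄})^{(p)} = ℤ_p(1)`, not constructed here), for every prime `p`.
Recorded as an existential over the tree's vocabulary, with NF base datum `(ℚ, i)`: there are an extension
`E`, an identification `i : G ≅ G_ℚ` and a continuous embedding `j : ℤ_p ↪ Π` with image `Δ` such that
(a) `Π` acts on `Δ = j(ℤ_p)` through the `p`-adic cyclotomic character of `G_ℚ` composed with the
augmentation ("`Δ = ℤ_p(1)`"); (b) `E` splits ([AbsAnab] §1.1), `Δ` is topologically finitely generated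
([AbsTopI] Prop 2.2) and `Δ ≠ 1`; (c) the Tate-module hypothesis of `thm26vi_of_tfgNormalSubgroup_trivial`
("`T_l(A)/G = 0`": every `Π`-invariant continuous character `Δ → ℤ_l` is trivial, all primes `l`) HOLDS;
(d) `E.Thm26vi` HOLDS: every continuous `Π → ℤ_l` kills `Δ`, `Δ` is the maximal topologically finitely
generated closed normal subgroup of `Π`, and `Π` is not topologically finitely generated.
Inputs by name: `GaloisRep.cyclotomicCharacter ℚ p` and `GaloisRep.cyclotomicCharacter_rat_surjective`
(`χ` is onto `ℤ_p^×`, in particular non-trivial), `NFBase.thm26vi_of_invariantCharacters_trivial`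
([AbsAnab] Thm 1.1.2 discharged in the tree), the generic semidirect-product topology lemmas
`SettingModel.Semidirect.*`. [cite: MochizukiAbsTopI2012, Thm 2.6 (vi) p.22] -/
theorem exists_cyclotomicModel_thm26vi (p : ℕ) [Fact p.Prime] :
    ∃ (E : FundamentalExtension.{0}) (i : E.gal ≃ₜ* Field.absoluteGaloisGroup ℚ)
      (j : Multiplicative ℤ_[p] →ₜ* E.arith),
      Function.Injective j ∧ j.toMonoidHom.range = E.geom ∧
      (∀ (g : E.arith) (a : ℤ_[p]), g * j (Multiplicative.ofAdd a) * g⁻¹ =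
        j (Multiplicative.ofAdd
          (((GaloisRep.cyclotomicCharacter ℚ p (i (E.aug g)) : ℤ_[p]ˣ) : ℤ_[p]) * a))) ∧
      E.SplitsOverOpenSubgroup ∧ E.GeomTFG ∧ E.geom ≠ ⊥ ∧
      (∀ (l : ℕ) [Fact l.Prime] (ψ : E.geom →ₜ* Multiplicative ℤ_[l]),
        (∀ (g : E.arith) (d d' : E.geom), (d' : E.arith) = g * d * g⁻¹ → ψ d' = ψ d) →
          ∀ d, ψ d = 1) ∧
      E.Thm26vi := by
  classical
  let Z : Type := Multiplicative ℤ_[p]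
  let Γ : Type := Field.absoluteGaloisGroup ℚ
  let χ : Γ →ₜ* ℤ_[p]ˣ := GaloisRep.cyclotomicCharacter ℚ p
  -- the action of `G_ℚ` on `ℤ_p(1)`: `σ ↦ (x ↦ χ(σ) • x)`
  let φ : Γ →* MulAut Z :=
    ((MulAutMultiplicative ℤ_[p]).symm.toMonoidHom.comp AddAut.mulLeft).comp χ.toMonoidHom
  have hφ : ∀ (σ : Γ) (x : Z),
      φ σ x = Multiplicative.ofAdd (((χ σ : ℤ_[p]ˣ) : ℤ_[p]) * Multiplicative.toAdd x) := fun _ _ => rfl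
  -- the topology of `ℤ_p(1) ⋊_χ G_ℚ`: induced along `g ↦ (g.left, g.right)`
  letI τ : TopologicalSpace (Z ⋊[φ] Γ) :=
    TopologicalSpace.induced (fun g : Z ⋊[φ] Γ => (g.left, g.right)) inferInstance
  have hι : IsInducing fun g : Z ⋊[φ] Γ => (g.left, g.right) := ⟨rfl⟩
  have hact : Continuous fun q : Γ × Z => φ q.1 q.2 := by
    have heq : (fun q : Γ × Z => φ q.1 q.2) = fun q =>
        Multiplicative.ofAdd (((χ q.1 : ℤ_[p]ˣ) : ℤ_[p]) * Multiplicative.toAdd q.2) :=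
      funext fun q => hφ q.1 q.2
    rw [heq]
    exact continuous_ofAdd.comp
      ((Units.continuous_val.comp ((map_continuous χ).comp continuous_fst)).mul
        (continuous_toAdd.comp continuous_snd))
  haveI : IsTopologicalGroup (Z ⋊[φ] Γ) := Semidirect.isTopologicalGroup_of_continuous_action hι hact
  haveI : CompactSpace (Z ⋊[φ] Γ) := Semidirect.compactSpace_of hι
  haveI : TotallyDisconnectedSpace (Z ⋊[φ] Γ) := Semidirect.totallyDisconnectedSpace_of hι
  -- the extension
  let E : FundamentalExtension.{0} :=
    { arith := ProfiniteGrp.of (Z ⋊[φ] Γ)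
      gal := absoluteGaloisGrp ℚ
      aug := Semidirect.rightHomCont hι
      aug_surjective := SemidirectProduct.rightHom_surjective }
  let i : E.gal ≃ₜ* Γ := ContinuousMulEquiv.refl _
  let B : E.NFBase := { F := ℚ, galIso := i }
  let j : Z →ₜ* E.arith := ⟨SemidirectProduct.inl, Semidirect.continuous_inl hι⟩
  -- `Δ = ker(right) = inl(ℤ_p)`
  have hmem_iff : ∀ g : E.arith, g ∈ E.geom ↔ (g : Z ⋊[φ] Γ).right = 1 := fun g => E.mem_geom
  have hrange : j.toMonoidHom.range = E.geom := by
    ext g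
    rw [hmem_iff]
    constructor
    · rintro ⟨x, rfl⟩
      rfl
    · intro hg
      refine ⟨(g : Z ⋊[φ] Γ).left, ?_⟩
      change SemidirectProduct.inl _ = g
      conv_rhs => rw [← SemidirectProduct.inl_left_mul_inr_right (g : Z ⋊[φ] Γ)]
      rw [hg, map_one, mul_one]
  have hinj : Function.Injective j := SemidirectProduct.inl_injective
  -- conjugation inside `ℤ_p ⋊_φ G_ℚ`: `(n,σ) · x · (n,σ)⁻¹ = φ σ x` (`ℤ_p` is commutative)
  have key : ∀ (n x : Z) (σ : Γ),
      (SemidirectProduct.inl n * SemidirectProduct.inr σ : Z ⋊[φ] Γ) * SemidirectProduct.inl x *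
        (SemidirectProduct.inl n * SemidirectProduct.inr σ)⁻¹ = SemidirectProduct.inl (φ σ x) := by
    intro n x σ
    calc (SemidirectProduct.inl n * SemidirectProduct.inr σ : Z ⋊[φ] Γ) * SemidirectProduct.inl x *
          (SemidirectProduct.inl n * SemidirectProduct.inr σ)⁻¹
        = SemidirectProduct.inl n *
            (SemidirectProduct.inr σ * SemidirectProduct.inl x * SemidirectProduct.inr σ⁻¹) *
            (SemidirectProduct.inl n)⁻¹ := by
          rw [map_inv, mul_inv_rev]
          simp only [mul_assoc]
      _ = SemidirectProduct.inl (n * φ σ x * n⁻¹) := by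
          rw [← SemidirectProduct.inl_aut, map_mul, map_mul, map_inv]
      _ = SemidirectProduct.inl (φ σ x) := by rw [mul_comm n, mul_inv_cancel_right]
  -- (a) `Π` acts on `Δ` through `χ ∘ aug`
  have hconj : ∀ (g : E.arith) (a : ℤ_[p]), g * j (Multiplicative.ofAdd a) * g⁻¹ =
      j (Multiplicative.ofAdd (((GaloisRep.cyclotomicCharacter ℚ p (i (E.aug g)) : ℤ_[p]ˣ) : ℤ_[p]) * a)) := by
    intro g a
    change (g : Z ⋊[φ] Γ) * SemidirectProduct.inl (Multiplicative.ofAdd a) * g⁻¹ =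
      SemidirectProduct.inl (Multiplicative.ofAdd (((χ (g : Z ⋊[φ] Γ).right : ℤ_[p]ˣ) : ℤ_[p]) * a))
    have h1 : (SemidirectProduct.inl
        (Multiplicative.ofAdd (((χ (g : Z ⋊[φ] Γ).right : ℤ_[p]ˣ) : ℤ_[p]) * a)) : Z ⋊[φ] Γ) =
        SemidirectProduct.inl (φ (g : Z ⋊[φ] Γ).right (Multiplicative.ofAdd a)) := by
      rw [hφ]
      rfl
    rw [h1, ← key (g : Z ⋊[φ] Γ).left (Multiplicative.ofAdd a) (g : Z ⋊[φ] Γ).right,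
      SemidirectProduct.inl_left_mul_inr_right]
  -- (b) the extension splits: `σ ↦ (0, σ)` is a continuous section over all of `G_ℚ`
  have hsplit : E.SplitsOverOpenSubgroup := by
    refine ⟨⊤, (⟨SemidirectProduct.inr, Semidirect.continuous_inr hι⟩ : Γ →ₜ* (Z ⋊[φ] Γ)).comp
      ⟨(⊤ : Subgroup Γ).subtype, continuous_subtype_val⟩, ?_, fun u => rfl⟩
    rw [Subgroup.coe_top]
    exact isOpen_univ
  -- `Δ ≅ ℤ_p` is topologically finitely generated ([AbsTopI] Prop 2.2 at the model)
  have htfg : E.GeomTFG := by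
    let jΔ : Z →ₜ* E.geom :=
      ⟨(SemidirectProduct.inl : Z →* Z ⋊[φ] Γ).codRestrict E.geom (fun z => (hmem_iff _).mpr rfl),
        (Semidirect.continuous_inl hι).subtype_mk _⟩
    have hjΔ : Function.Surjective jΔ := by
      rintro ⟨g, hg⟩
      refine ⟨(g : Z ⋊[φ] Γ).left, Subtype.ext ?_⟩
      change SemidirectProduct.inl _ = g
      conv_rhs => rw [← SemidirectProduct.inl_left_mul_inr_right (g : Z ⋊[φ] Γ)]
      rw [(hmem_iff g).mp hg, map_one, mul_one]
    exact (isTopologicallyFinitelyGenerated_multiplicative_padicInt p).of_surjective jΔ hjΔ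
  -- `Δ ≠ 1`
  have hne : E.geom ≠ ⊥ := by
    intro h
    have h1 : j (Multiplicative.ofAdd (1 : ℤ_[p])) ∈ E.geom := hrange ▸ ⟨_, rfl⟩
    rw [h, Subgroup.mem_bot] at h1
    have h2 : Multiplicative.ofAdd (1 : ℤ_[p]) = 1 := hinj (by rw [h1, map_one])
    exact one_ne_zero (ofAdd_eq_one.mp h2)
  -- `χ` is non-trivial: some `σ₀ ∈ G_ℚ` acts on `ℤ_p(1)` as `-1` (the tree's surjectivity of `χ_p` on `G_ℚ`)
  obtain ⟨σ₀, hσ₀⟩ := GaloisRep.cyclotomicCharacter_rat_surjective p (-1)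
  -- (c) the Tate-module hypothesis `hT` ("`T_l(A)/G = 0`") HOLDS at the model, for every prime `l`
  have hT : ∀ (l : ℕ) [Fact l.Prime] (ψ : E.geom →ₜ* Multiplicative ℤ_[l]),
      (∀ (g : E.arith) (d d' : E.geom), (d' : E.arith) = g * d * g⁻¹ → ψ d' = ψ d) →
        ∀ d, ψ d = 1 := by
    intro l _ ψ hψ d
    refine E.invariantCharacters_trivial_of_conj_eq_mul j.toMonoidHom hrange
      (SemidirectProduct.inr σ₀ : Z ⋊[φ] Γ) (-1) ?_ ?_ l ψ hψ d
    · intro h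
      have h2 : (2 : ℤ_[p]) = 0 := by linear_combination -h
      exact two_ne_zero h2
    · intro a
      have h := hconj (SemidirectProduct.inr σ₀ : Z ⋊[φ] Γ) a
      have hr : i (E.aug (SemidirectProduct.inr σ₀ : Z ⋊[φ] Γ)) = σ₀ := rfl
      rw [hr] at h
      change (SemidirectProduct.inr σ₀ : Z ⋊[φ] Γ) * j (Multiplicative.ofAdd a) * _ =
        j (Multiplicative.ofAdd ((-1) * a))
      rw [h, hσ₀, Units.val_neg, Units.val_one]
  refine ⟨E, i, j, hinj, hrange, hconj, hsplit, htfg, hne, hT, ?_⟩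
  -- (d) Thm 2.6 (vi) AS TYPED, via the in-tree conditional form ([AbsAnab] Thm 1.1.2 discharged there)
  exact NFBase.thm26vi_of_invariantCharacters_trivial B htfg hT

end FundamentalExtension

end Literature.AnabelianGeometry.AbsoluteAnabelian

end
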